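import Literature.RingTheory.KrullDimension.AffineCatenary
import Mathlib.RingTheory.Nullstellensatz
import Mathlib.RingTheory.Ideal.KrullsHeightTheorem
import HarnessLib

/-!
# The fibre-dimension inequality for affine domains (all fibres)

Standard commutative algebra (the algebraic content of Springer, *Linear Algebraic Groups*,
2nd ed., 5.1.6 / 5.2.7 and Shafarevich, *Basic Algebraic Geometry 1*, I.6.3 Thm 1.25: *the
non-empty fibres of a morphism `X → Y` of irreducible varieties have all their components of
dimension `≥ dim X - dim Y`*), in continuation of `AffineCatenary.lean` (the dimension formula
`dim (A ⧸ P) + height P = dim A` for affine domains) and complementary to `FibreDimension.lean`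
(which proves the *generic equidimensionality* `dim = dim X - dim Y` of the fibres over a dense
open subset; here the *inequality* for **every** fibre). For an `F`-algebra map `φ : B → A` of
domains finitely generated over an algebraically closed field `F` and a maximal ideal `m` of `B`
(a rational point `y` of `Y = Spec B`), the fibre over `y` is cut out in `X = Spec A` by the
ideal `m A`, and its irreducible components are the minimal primes `P` of `m A`. We prove:

* `vanishingIdeal_singleton_eq_span` — the maximal ideal of a rational point of affine space is
  generated by the `Xᵢ - xᵢ`;
* **`height_le_of_mem_minimalPrimes_map`** — `height P ≤ dim B` for every minimal prime `P` of
  `m A` (Matsumura Thm 15.1 (i) in this case): Noether-normalise `F[y₁, …, y_e] ⊆ B`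
  (`e = dim B`); `m ∩ F[y]` is the ideal of a point, generated by `e` elements, and `P` is
  still minimal over the ideal they generate in `A` (maximal ideals of `B` are determined by
  their contraction to `F[y]` up to incomparability), so Krull's height theorem applies;
* **`ringKrullDim_le_ringKrullDim_quotient_add`** — hence `dim A ≤ dim (A ⧸ P) + dim B`, i.e.
  every component of a non-empty fibre has dimension `≥ dim X - dim Y`;
* `ringKrullDim_le_of_injective` — for `φ` injective (a dominant morphism), `dim B ≤ dim A`
  (transcendence degree is monotone, Mathlib `trdeg_le_of_injective`).

## References

* H. Matsumura, *Commutative Ring Theory*, CUP (1986), Thm 5.6, Thm 15.1.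
* T. A. Springer, *Linear Algebraic Groups*, 2nd ed. (1998), 5.1.6, 5.2.7.
-/

noncomputable section

open Order

namespace Literature.RingTheory.KrullDimension

/-! ### The ideal of a rational point of affine space -/

section Point

variable {F : Type*} [Field F] {σ : Type*}

/-- **The ideal of a rational point is generated by the `Xᵢ - xᵢ`**: for `x ∈ F^σ`, the
polynomials vanishing at `x` form the ideal `(Xᵢ - xᵢ)ᵢ` (modulo this ideal every polynomial is
congruent to its value at `x`). [folklore] -/
theorem vanishingIdeal_singleton_eq_span (x : σ → F) :
    (MvPolynomial.vanishingIdeal F {x} : Ideal (MvPolynomial σ F)) =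
      Ideal.span (Set.range fun i => MvPolynomial.X i - MvPolynomial.C (x i)) := by
  set n₀ : Ideal (MvPolynomial σ F) :=
    Ideal.span (Set.range fun i => MvPolynomial.X i - MvPolynomial.C (x i)) with hn₀
  apply le_antisymm
  · intro p hp
    rw [MvPolynomial.mem_vanishingIdeal_singleton_iff] at hp
    -- modulo `n₀`, every polynomial is congruent to its value at `x`
    have key : (Ideal.Quotient.mkₐ F n₀ : MvPolynomial σ F →ₐ[F] MvPolynomial σ F ⧸ n₀) =
        ((Ideal.Quotient.mkₐ F n₀).comp (Algebra.ofId F (MvPolynomial σ F))).comp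
          (MvPolynomial.aeval x) := by
      apply MvPolynomial.algHom_ext
      intro i
      simp only [AlgHom.coe_comp, Function.comp_apply, MvPolynomial.aeval_X,
        Ideal.Quotient.mkₐ_eq_mk, Algebra.ofId_apply, MvPolynomial.algebraMap_eq]
      rw [Ideal.Quotient.mk_eq_mk_iff_sub_mem]
      exact Ideal.subset_span ⟨i, rfl⟩
    have h := congrArg (fun f => f p) key
    simp only [AlgHom.coe_comp, Function.comp_apply, Ideal.Quotient.mkₐ_eq_mk, hp, map_zero]
      at h
    exact Ideal.Quotient.eq_zero_iff_mem.1 h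
  · rw [hn₀, Ideal.span_le]
    rintro _ ⟨i, rfl⟩
    rw [SetLike.mem_coe, MvPolynomial.mem_vanishingIdeal_singleton_iff]
    simp

end Point

/-! ### The fibre inequality -/

section Fibre

variable (F : Type*) [Field F] [IsAlgClosed F]
variable {A B : Type*} [CommRing A] [IsDomain A] [Algebra F A] [Algebra.FiniteType F A]
  [CommRing B] [IsDomain B] [Algebra F B] [Algebra.FiniteType F B]

omit [IsDomain A] in
include F in
/-- **Components of fibres over rational points have bounded height** (Matsumura Thm 15.1 (i)
for a maximal ideal of the base; Springer 5.1.6 (ii)): for an `F`-algebra map `φ : B → A` of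
affine domains over an algebraically closed field, a maximal ideal `m ⊆ B` and a minimal prime
`P` of `m A`, `height P ≤ dim B`. [cite: Matsumura1987, Thm 15.1] -/
theorem height_le_of_mem_minimalPrimes_map (φ : B →ₐ[F] A) (m : Ideal B) [m.IsMaximal]
    (P : Ideal A) [P.IsPrime] (hP : P ∈ (m.map φ).minimalPrimes) :
    (P.height : WithBot ℕ∞) ≤ ringKrullDim B := by
  classical
  haveI : IsNoetherianRing A := Algebra.FiniteType.isNoetherianRing F A
  -- Noether normalization of `B`
  obtain ⟨e, g, hinj, hint⟩ := exists_integral_inj_algHom_of_fg F B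
  letI alg : Algebra (MvPolynomial (Fin e) F) B := g.toRingHom.toAlgebra
  haveI : Algebra.IsIntegral (MvPolynomial (Fin e) F) B := ⟨fun b => hint b⟩
  have hinj' : Function.Injective (algebraMap (MvPolynomial (Fin e) F) B) := hinj
  have hB : ringKrullDim B = e := by
    rw [← ringKrullDim_eq_of_isIntegral hinj', MvPolynomial.ringKrullDim_of_isNoetherianRing,
      ringKrullDim_eq_zero_of_field, Nat.card_eq_fintype_card, Fintype.card_fin, zero_add]
  -- `m₀ = m ∩ F[y]` is the ideal of a point `x`
  haveI hm₀ : (m.comap (algebraMap (MvPolynomial (Fin e) F) B)).IsMaximal :=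
    Ideal.isMaximal_comap_of_isIntegral_of_isMaximal m
  obtain ⟨x, hx⟩ := MvPolynomial.eq_vanishingIdeal_singleton_of_isMaximal F hm₀
  rw [vanishingIdeal_singleton_eq_span] at hx
  -- the images in `A` of the generators `Xᵢ - xᵢ`
  set gen : Fin e → A := fun i => φ (g (MvPolynomial.X i - MvPolynomial.C (x i))) with hgen
  set S : Finset A := Finset.univ.image gen with hS
  have hgenm : ∀ i, g (MvPolynomial.X i - MvPolynomial.C (x i)) ∈ m := by
    intro i
    have : MvPolynomial.X i - MvPolynomial.C (x i) ∈
        m.comap (algebraMap (MvPolynomial (Fin e) F) B) := by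
      rw [hx]; exact Ideal.subset_span ⟨i, rfl⟩
    exact this
  -- `P` is a minimal prime of the ideal generated by the `e` elements `gen i`
  have hPmin : P ∈ (Ideal.span (S : Set A)).minimalPrimes := by
    refine ⟨⟨inferInstance, ?_⟩, ?_⟩
    · rw [Ideal.span_le]
      intro a ha
      rw [hS, Finset.coe_image, Set.mem_image] at ha
      obtain ⟨i, -, rfl⟩ := ha
      exact hP.1.2 (Ideal.mem_map_of_mem _ (hgenm i))
    · rintro P' ⟨hP'prime, hSP'⟩ hP'P
      -- the contraction `q' = φ⁻¹ P'` is a maximal ideal, equal to `m`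
      haveI := hP'prime
      set q' : Ideal B := P'.comap φ.toRingHom with hq'
      have hq₀ : q'.comap (algebraMap (MvPolynomial (Fin e) F) B) =
          m.comap (algebraMap (MvPolynomial (Fin e) F) B) := by
        refine (hm₀.eq_of_le (Ideal.IsPrime.ne_top inferInstance) ?_).symm
        rw [hx, Ideal.span_le]
        rintro _ ⟨i, rfl⟩
        rw [SetLike.mem_coe, Ideal.mem_comap, hq', Ideal.mem_comap]
        have hmem : gen i ∈ P' := hSP' (Ideal.subset_span (by
          rw [hS, Finset.coe_image]
          exact ⟨i, Finset.mem_coe.2 (Finset.mem_univ i), rfl⟩))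
        exact hmem
      have hq'max : q'.IsMaximal :=
        Ideal.isMaximal_of_isIntegral_of_isMaximal_comap q' (hq₀ ▸ hm₀)
      have hmle : m ≤ P.comap φ.toRingHom := by
        rw [← Ideal.map_le_iff_le_comap]; exact hP.1.2
      have hq'le : q' ≤ P.comap φ.toRingHom := Ideal.comap_mono hP'P
      have hPc : P.comap φ.toRingHom ≠ ⊤ := Ideal.comap_ne_top _ (Ideal.IsPrime.ne_top inferInstance)
      have hq'm : q' = m :=
        (hq'max.eq_of_le hPc hq'le).trans ((inferInstance : m.IsMaximal).eq_of_le hPc hmle).symm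
      -- hence `m A ≤ P'` and `P ≤ P'` by minimality of `P` over `m A`
      have hmP' : m.map φ ≤ P' := by
        rw [Ideal.map_le_iff_le_comap, ← hq'm, hq']
        intro b hb
        simpa [Ideal.mem_comap] using hb
      exact hP.2 ⟨hP'prime, hmP'⟩ hP'P
  -- Krull's height theorem
  have h := Ideal.height_le_card_of_mem_minimalPrimes_span_finset hPmin
  have hcard : S.card ≤ e := Finset.card_image_le.trans (by simp)
  calc (P.height : WithBot ℕ∞) ≤ ((S.card : ℕ∞) : WithBot ℕ∞) := by exact_mod_cast h
    _ ≤ ((e : ℕ∞) : WithBot ℕ∞) := by exact_mod_cast hcard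
    _ = ringKrullDim B := hB.symm

include F in
/-- **The fibre-dimension inequality** (Springer 5.1.6 (ii); Shafarevich I.6.3 Thm 1.25): for
`φ : B → A` as above, a maximal ideal `m ⊆ B` and a minimal prime `P` of `m A` — an irreducible
component of the fibre over the point `m` — one has `dim A ≤ dim (A ⧸ P) + dim B`, i.e.
`dim (component) ≥ dim A - dim B`. From `height_le_of_mem_minimalPrimes_map` and the dimension
formula `ringKrullDim_quotient_add_height`. [cite: Matsumura1987, Thm 15.1] -/
theorem ringKrullDim_le_ringKrullDim_quotient_add (φ : B →ₐ[F] A) (m : Ideal B) [m.IsMaximal]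
    (P : Ideal A) [P.IsPrime] (hP : P ∈ (m.map φ).minimalPrimes) :
    ringKrullDim A ≤ ringKrullDim (A ⧸ P) + ringKrullDim B := by
  rw [← ringKrullDim_quotient_add_height F P]
  have h := height_le_of_mem_minimalPrimes_map F φ m P hP
  gcongr

omit [IsAlgClosed F] in
include F in
/-- **Dominant morphisms do not increase dimension**: an injective `F`-algebra map `φ : B → A`
of affine domains gives `dim B ≤ dim A` (`dim = trdeg`, and the transcendence degree is
monotone under injective algebra maps). [cite: Matsumura1987, Thm 5.6] -/
theorem ringKrullDim_le_of_injective (φ : B →ₐ[F] A) (hφ : Function.Injective φ) :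
    ringKrullDim B ≤ ringKrullDim A := by
  rw [ringKrullDim_eq_trdeg F A, ringKrullDim_eq_trdeg F B]
  have h := lift_trdeg_le_of_injective φ hφ
  have hfin : Cardinal.lift.{u_3} (Algebra.trdeg F A) < Cardinal.aleph0 := by
    rw [Cardinal.lift_lt_aleph0, trdeg_eq_toNat F A]; exact Cardinal.natCast_lt_aleph0
  have h' := Cardinal.toNat_le_toNat h hfin
  simp only [Cardinal.toNat_lift] at h'
  exact_mod_cast h'

end Fibre

end Literature.RingTheory.KrullDimension
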